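import Summits.BirchSwinnertonDyer.Rank1Residual.X11b.ShapiroPairs
import HarnessLib

/-!
# BSD rank-≤1 residual cell, GOOD reduction at `p = 3` (supersingular) with mod-3 image `3Nn`
# (normaliser of a NON-split Cartan, order 16, prime to 3) — the book's `JET@nonsurj@3` REMAINDER, TRANCHE B escalation row (series JetB): `BSD(E,3)` per pair (`r_an ≤ 1`, `3 ∤ #Ш_an`,
# `N < 5·10⁵`) from PUBLISHED theorems + ONE EXACT 3-descent certificate line on TWO engines — batch 06 of 6 (the K1 escalation row 431584a1: engine 1 kit j336839, JOB_MAXTRIES=3000000, at v = 13487)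

HONEST FRAMING (cell `b2b-bsdres-*`, verbatim): prove what is provable now; shrink each hard class to its core with data;
no claim beyond stated classes; COMBINATION classes deleted from PUBLISHED theorems only, CONSTRUCTION-shaped remainder
typed; this is not "finishing BSD". X7 / X8 stay CONSTRUCTION-SHAPED as classes; everything here is PER PAIR; no lane
verdict is changed; no named fact, no definition; nothing is booked by this unit (the lane offers, the referee rules).
Unit `b2b-bsdres-x10` GEN 56 (prover-b2b-bsdres-x10-g56-0; X10 / N2 class lead at `p = 3`; move «SEL3X-3NN-JETREM»,
X10-AUDIT.md §62).

WHY. On referee A's state of record after ROUND 1102 (canonical aa0cf75527a8da45) 463 book rows are LITERAL with the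
register EXACTLY `{JET@nonsurj@3}` and no open cell: good reduction at `3` (460 supersingular, 3 ordinary), mod-3 image
`3Nn`, `r_an ≤ 1` (414 of rank 1, 49 of rank 0), `3 ∤ #tors · #Ш_an`, `3 ∣ ∏ c_ℓ` — the lane's certificate there used the
Heegner-index bound with Jetchev's Tamagawa sharpening outside its printed Hypothesis (∗) (`ρ̄_{E,3}` surjective), hence the
flag. On such a row the `3`-part of BSD is the statement `Ш(E/ℚ)[3] = 0`, and the tree's CLASS-FREE, IMAGE-FREE consumer
`Typed.bsdp_of_card_selmerGroup_eq_pow_analyticRank` (GZK + `r_an ≤ 1` + `3 ∤ #Ш_an` + the ONE line `#Sel^(3)(E/ℚ) = 3^{r_an}`;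
no image hypothesis, no Tamagawa condition — the Tamagawa factor sits inside `#Ш_an`) closes it from an exact `3`-descent,
exactly as additive-p3 GEN 18 did for the 205 residual `3Nn` cells (`Supersingular/NonsplitCartanThreeDescentRecordsX7Three01–07`,
`…X8Three01–05`; referee A2 ROUND 1022 booked bsd-jet's 25 literal rank-0 rows of the same shape through the same door).
additive-p3 GEN 18 ran BOTH exact engines over the WHOLE universe of 1 673 Cremona curves with good supersingular reduction
at `3`, image `3Nn`, rank `≤ 1` (engine 1 kit j131308, engine 2 kit j131426) but filed theorems only for its residual cells;
THIS SERIES files the remaining TWO-ENGINE-EXACT rows that are literal in the book (x10's join `out56/ss3nn_join.tsv`: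
364 rows with `K_S = 0` on engine 2 = series Jet; tranche B rows follow after re-runs).

ENGINE CREDIT (all files RUN UNCHANGED; nothing of the mathematics is x10's): ENGINE 1 = unit `b2b-bsdres-x11b`'s exact-element
3-descent `desc3lib.gp` (Schaefer–Stoll in the octic étale algebra `A = ℚ[x]/(ψ₃)`, one Galois orbit on `E[3]∖0` ⟸ image `3Nn`;
sha256 c4fb20b7…) with its gen-8 driver `entry.gp` in EXACT mode (`bnfcertify(A) = 1` + 3-saturation of the S-units by cubic
characters; every listed Selmer element exact; analytic rank re-computed by PARI; rank-1 rows: Cremona's generator LOCATED in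
the computed Selmer group) via unit `b2b-bsdres-x11c` GEN 15's kit (`main.py` 78a19635…, `chunk_runner.py` 74b94fe3…,
`entry.gp` 1efb1f5d…), run by additive-p3 GEN 18 as kit j131308 (all 1 673 curves; `HOME/b2b-bsdres-additive-p3/g18/desc3nnSS/
j131308_engine1_full/`, certificate bodies `certs.tar.gz` 22c73fa3…) and kit j131863 (the 217 cells, TMAX 1500). ENGINE 2 =
x11c GEN 15's `descentPlib.gp` 3b7a8c5e… FULL (Maschke) mode at `p = 3` in the degree-8 field `R = ℚ(T′)` (`run_P.gp` 2a67a359…;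
the SEL3X engine of record at referee A2's desk, R654 / R662 / R1022), additive-p3 GEN 18 kit j131426 (`…/j131426_engine2/summary.tsv`);
certificate BODIES re-derived byte-copy by x10 GEN 56's LEG E2R (kit `x10-jetrem-E2R-A364`) and re-verified by LEG V
(`verify_P.gp` 06d6b2f3…) — job ids, hashes and per-row data in the offer keys `class-closure/N2/SEL3X-3NN-JETREM-KEYS-x10g56-A.tsv`.
The local condition `dim E(ℚ_ℓ)/3E(ℚ_ℓ) = dim E(ℚ_ℓ)[3] + [ℓ = 3]` used by both engines holds for every reduction type, so the
Tamagawa-divisible primes of these rows are ordinary input.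

What enters the kernel per pair is ONE line: `hSel : #Sel^(3)(E/ℚ) = 3 ^ r_an` of the tree's class-free consumer
`Typed.bsdp_of_card_selmerGroup_eq_pow_analyticRank` through x11c gen 12's `X11b.bsdp_of_ainvs_of_card_selmerGroup`
(GZK `hGZK`, `r_an ≤ 1`, `3 ∤ #Ш_an`; `Δ ≠ 0` by `decide`). Non-kernel inputs per pair: `r_an`, `#Ш_an` (Cremona `allbsd`;
rank-1 rows: the displayed analytic order) and the certificate line. References: Schaefer–Stoll, Trans. AMS 356 (2004)
[SchaeferStoll2004]; Silverman, *AEC* X.1, X.4 [SilvermanAEC2009]; Miller, LMS JCM 14 (2011) §1 [Miller2011LMS];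
Cremona [Cremona2006].
-/

set_option autoImplicit false

noncomputable section

open scoped Classical

open WeierstrassCurve Literature.NumberTheory.EllipticCurves
  Literature.NumberTheory.EllipticCurves.Rank1Residual
  Literature.NumberTheory.EllipticCurves.Rank1Residual.Typed
  Literature.NumberTheory.EllipticCurves.Rank1Residual.X11RankOneCertificates
  Summit.BirchSwinnertonDyer.Rank1Residual.X11b

namespace Summit.BirchSwinnertonDyer.Rank1Residual.Supersingular

/-- **`BSD(E,3)` for `431584a1`** [TWO-ENGINE EXACT] (book: LITERAL, register `{JET@nonsurj@3}` only; class X8@3 (`a_3 = -3`): `N = 431584`, good supersingular at `3`; Cremona model `[0, 0, 0, -913, -602960]`; `ρ̄_{E,3}` = `3Nn`; rank `1`, Cremona generator `(36081/25,6851396/125)`; `#Ш_an = 1`, `∏ c_ℓ = 6`, `#tors = 1`)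
from GZK and the certificate line `#Sel^(3)(E/ℚ) = 3 ^ r_an`: ENGINE 1 EXACT 3-descent (x11b `desc3lib.gp` via x11c's GEN-15 kit, x10 GEN 56 LEG E1R kit j336839 (desc3lib.gp byte-identical; driver entry.gp x10-r1 = sampler knobs by env)):
octic algebra `A = ℚ[x]/(ψ₃)` with `|d_A| ≈ 10^8`, `S = {2, 3, 13487}`, `Cl(A) = [1, []]` CERTIFIED (`bnfcertify = 1`), `11` generators of `A(S,3)` (3-saturated by
cubic characters), `dim H¹(ℚ,E[3];S) = 2`, local images at every `ℓ ∈ S` reached, **`dim Sel^(3)(E/ℚ) = 1 = rank`** (PARI analytic-rank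
datum `[1, 6.01397692013524]`; MW: `mw:cremona-allgens:rank>=1 pts=1 F(P) in <Sel> as [[2]]`) ⟹ **`#Sel^(3)(E/ℚ) = 3^1`**, mode `EXACT(bnfcertify1+3sat)`. SECOND ENGINE (x11c `descentPlib.gp` full mode `p = 3`, degree-8 field `R`, x10 GEN 56 LEG E2R kit j335707 (byte-identical bundle, sampler knobs JOB_MAXTRIES / JOB_PREC by env)): dim Fake = dim Sel³ = 1 [EXACT, `bnfcertify = 1`, K_S 0, Cl(R) [1, []]]; MW image independent/non-zero in Fake: 1; — AGREES. Kernel: `Δ ≠ 0`. Binders: `hGZK`, `r_an ≤ 1`, `#Ш_an` a `3`-unit, `hSel`. Nothing booked.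
[cite: Miller2011LMS, §1 and Def. 1.1] [cite: Cremona2006, Table 1 (Cremona label 431584a1)] -/
theorem bsdp3_nn431584a1 (hGZK : rank_eq_analyticRank_of_analyticRank_le_one)
    (W : WeierstrassCurve ℚ) (hW : W = ⟨0, 0, 0, -913, -602960⟩)
    (hr : W.analyticRank ≤ 1) {q : ℚ} (hq : shaAn W = (q : ℂ)) (hv : padicValRat 3 q = 0)
    (hSel : Nat.card (W.selmerGroup (3 : ℤ)) = 3 ^ W.analyticRank) : BSDp W 3 := by
  subst hW
  haveI : Fact (Nat.Prime 3) := ⟨by norm_num⟩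
  exact bsdp_of_ainvs_of_card_selmerGroup hGZK 0 0 0 (-913) (-602960) (by decide +kernel) 3 hr hq hv hSel

end Summit.BirchSwinnertonDyer.Rank1Residual.Supersingular

end
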